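import Summits.BirchSwinnertonDyer.BirchSwinnertonDyer.Theorems.PrintX9MuPartStubAHowardInputsOfClauses
import Summits.BirchSwinnertonDyer.BirchSwinnertonDyer.Theorems.PrintX10bStubAExactAtP
import Summits.BirchSwinnertonDyer.BirchSwinnertonDyer.Theorems.PrintX9MuPartStubH5bAtSZeroPClosed
import HarnessLib

/-!
# The KS μ-chain is CLASS-NUMBER-FREE, I: STUB A (Howard's inputs for the Eisenstein DVR settings) WITHOUT the idle binders
# `¬ W.HasCM`, `MastellaZerman2026.HasPadicScalarImage W p`, `p ∣ NumberField.classNumber K`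

Cell `run/shared/lean/pub/bsd-print-x9/`, seat bsd-line-x10b-p1 LEAD g11; `--supports stmt-BirchSwinnertonDyer-23055` (helper; it also
serves the KS road of 22642/23237 and row 9). THEOREMS ONLY: no definition, no `abbrev`, no named fact, no instance, no `sorry`; no
`Theses` import (route-free).

FINDING «hhK-IDLE» (2026-08-29, tree read). The letters of the KS μ-chain (x10b-p1 LEAD g10's F1–F5 over D1's STUB A and the
(B4)/(B5) readouts) all carry the binder prefix `¬ W.HasCM → W.HasIrreducibleModPGaloisRep p →
(W.baseChange K).HasIrreducibleModPGaloisRep p → MastellaZerman2026.HasPadicScalarImage W p → SatisfiesHeegnerHypothesis p K →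
p ∣ NumberField.classNumber K → …`, inherited from the μ-crux frames of rows 9/10 (where `p ∣ h_K` selects the CGLS «any class number»
branch and MZ26 Cor. 4.6 serves `p ∤ h_K`). But NO PROOF in the chain uses `¬CM`, the scalar image or `p ∣ h_K`: the bottom stubs
introduce them as `_` (`HeegnerMuPartKSLink.ksLink_of_thm411`: `intro … hyp _ _ _ _ _ _ D C X …`;
`HeegnerMuPartControlGlue.stub_readoutSelmerKS` and the three local readout clauses: `intro … _hCM _hirr _hirrK _hsc hHp _hhK`), and the
compositions (`howardInputs_of_clauses`, `readoutIndexKS_of_local`, `controlGlueKS_of_clauses`, `portCyclic_of_ks`) only pass them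
down; the H.4/H.5/Poitou–Tate letters, the Eisenstein-setting constructor
`exists_eisensteinSettingData_satisfiesH_eRed_of_thm413Hypotheses`, the compact control
`PrintX10bCompactControl.exists_forall_compactInputs_eisensteinDVRSetting`, the coherent-pair engine `exists_coherent_pair_envelope_class`
and p689159 §1 have no such hypotheses at all. So the KS road (Howard Thm. 1.6.1 + CGLS Thm. 4.1.1 ⟹ the coherent-pair μ-letter with
torsion and μ-inequality) holds on EVERY `Thm413Hypotheses` frame with (irr_ℚ), (irr_K), (Heeg_p) — ANY class number. Consequence for
crux 23055 (`BeyondCarrierDepthX10b`): the `3 ∤ h_K` frames no longer need Mastella–Zerman 2026 Cor. 4.6 (leaf `h46`); the census drops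
to TEN cite-only leaves with no case split (file `PrintX10bBeyondCarrierOfTenPrintLeaves`, after parts II–III).

This file = part I, the STUB-A side re-threaded with the shorter binder prefix `hyp → irr_ℚ → irr_K → Heeg_p → D C X z …`
(statements are the letters `HeegnerMuPartStubA.Stmt.ksLink` / `Stmt.howardInputsCore` with the three idle binders deleted, spelled
out as theorem types; proofs are the landed ones VERBATIM with the three underscores / pass-through arguments removed):
* `ksLink_anyClassNumber (h411)` — twin of `HeegnerMuPartKSLink.ksLink_of_thm411` (p666139);
* `howardInputsCore_anyClassNumber_of_clauses (hPT H4 H5) (h411)` — twin of `HeegnerMuPartStubA.howardInputs_of_clauses`;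
* `howardInputsCore_anyClassNumber (h411)` — the closed form: Poitou–Tate `HeegnerMuPartH4AtS.poitouTate_holds`, H.4 ⟸ (Exact)
  `h4AtS_of_exactAtP' stub_exactAtP`, H.5(b) ⟸ `h5bAtSERed_of_clauseZeroP stub_h5bAtSZeroP` (all kernel theorems).
HONEST FRAMING: conditional on F-411 (`thm411_exists_kolyvaginSystem_one_ne_zero`, statement-only); nothing new is asserted about
any leaf; «beyond-print theorem»: no; no summit statement is proved; BSD is NOT proved by any of this.

References: [Howard2004HeegnerKolyvagin] §1.3 H.0–H.5, Thm. 1.6.1, §2.2, proof of Thm. 2.2.10; [CastellaGrossiLeeSkinner2022]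
Thm. 4.1.1, Rem. 4.1.4, §3.2, §3.4 (standing hypotheses: no class-number condition); [MilneADT2006] I Thm. 4.10.
-/

set_option linter.dupNamespace false
set_option autoImplicit false

noncomputable section

open scoped Classical Pointwise ContRepresentation TensorProduct NumberField

open Function NumberField IsDedekindDomain Field
open Literature Literature.NumberTheory.EllipticCurves WeierstrassCurve
open Literature.NumberTheory.GaloisCohomology Literature.NumberTheory.GaloisCohomology.Howard2004
open Literature.NumberTheory.Automorphic
open Literature.NumberTheory.EllipticCurves.ZpExtension (EisensteinLevel)
open Literature.NumberTheory.GaloisRepresentations Literature.NumberTheory.GaloisRepresentations.DiscreteGaloisModule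
open Summit.BirchSwinnertonDyer.BirchSwinnertonDyer.Theorems

namespace Summit.BirchSwinnertonDyer.BirchSwinnertonDyer.Theorems.HeegnerMuPartKSAnyClassNumber

/-! ## §1 The KS-LINK without the idle binders -/

set_option synthInstance.maxHeartbeats 80000 in
/-- **The `ksLink` content of STUB A from CGLS Thm. 4.1.1 (F-411), for ANY class number** — the letter
`HeegnerMuPartStubA.Stmt.ksLink` with the idle binders `¬ W.HasCM`, `HasPadicScalarImage`, `p ∣ h_K` DELETED (the landed proof
`HeegnerMuPartKSLink.ksLink_of_thm411` introduces all of them as `_`): the KS side chooses `S = {v ∣ pN}`, the threshold `m₁` of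
`exists_ksLink_of_thm411`, tame pins, `𝓛 = 𝓛_E` with `𝓛₁(T_𝔮) ∖ S ⊆ 𝓛_E`, `t = (p ·)`, `I = eisensteinH1Limit`, `jbar′ = jbar`, and
for every conjugation datum / H.4 data / `SatisfiesH` witness a Kolyvagin system whose bottom class is the compact control image of
`z`, non-zero. Proof verbatim. [cite: CastellaGrossiLeeSkinner2022, Thm. 4.1.1, Rem. 4.1.4, §3.2, §3.4]
[cite: Howard2004HeegnerKolyvagin, Rem. 1.2.4, §1.6, proof of Thm. 2.2.10] -/
theorem ksLink_anyClassNumber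
    (h411 : Literature.NumberTheory.EllipticCurves.CastellaGrossiLeeSkinner2022.thm411_exists_kolyvaginSystem_one_ne_zero) :
  ∀ (N : ℕ) [NeZero N] (W : WeierstrassCurve ℚ) [W.IsGloballyMinimal] (K : Type) [Field K] [NumberField K]
    (p : ℕ) [Fact p.Prime] (κ : ZpExtension K p) (γ : Field.absoluteGaloisGroup K)
    (jbar : AlgebraicClosure K →+* ℂ) (hyp : CastellaGrossiLeeSkinner2022.Thm413Hypotheses N W K p κ γ),
    W.HasIrreducibleModPGaloisRep p → (W.baseChange K).HasIrreducibleModPGaloisRep p →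
    SatisfiesHeegnerHypothesis p K →
    ∀ (D : (W.baseChange K).LambdaAdicSelmerData κ γ)
      (C : CastellaGrossiLeeSkinner2022.StabilizedHeegnerData N W K κ jbar)
      (X : (W.baseChange K).SelmerDualData κ γ) (z : D.S),
    (∀ (k : ℕ) (hk : C.depth < k), D.proj k z ∈ CastellaGrossiLeeSkinner2022.stabilizedClassLayer C k hk) →
    CastellaGrossiLeeSkinner2022.stabilizedHeegnerModule D C = Submodule.span (IwasawaAlgebra p) {z} →
    Module.Finite (IwasawaAlgebra p) D.S → Module.Finite (IwasawaAlgebra p) X.X →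
    Module.IsTorsion (IwasawaAlgebra p) (D.S ⧸ CastellaGrossiLeeSkinner2022.stabilizedHeegnerModule D C) →
    haveI := hyp.isElliptic
    ∃ (S : Finset (HeightOneSpectrum (𝓞 K)))
      (hpS : ∀ v, ((p : ℕ) : 𝓞 K) ∈ v.asIdeal → v ∈ S)
      (hbad : ∀ v, v ∉ S → ((p : ℕ) : 𝓞 K) ∉ v.asIdeal → (W.baseChange K).HasGoodReductionAt v)
      (_hSN : ∀ v ∈ S, ((p : ℕ) : 𝓞 K) ∈ v.asIdeal ∨ ((N : ℕ) : 𝓞 K) ∈ v.asIdeal)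
      (_hSσ : ∀ (σ : K ≃ₐ[ℚ] K) (v : HeightOneSpectrum (𝓞 K)), σ • v ∈ S → v ∈ S)
      (m₁ : ℕ), ∀ (m : ℕ) (hm : 1 ≤ m), m₁ ≤ m →
      letI := IwasawaAlgebra.isDomain_quotient_X_pow_add_C p hm
      letI := IwasawaAlgebra.isDiscreteValuationRing_quotient_X_pow_add_C p hm
      haveI := IwasawaAlgebra.EisensteinCoeff.isLocalRing_succ p hm
      letI := IwasawaAlgebra.EisensteinCoeff.algebraOfSpecSucc p m
      haveI := W.isScalarTower_algebraOfSpecSucc (K := K) (p := p) (m := m)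
      letI := W.residueModuleSucc (K := K) (p := p) hm
      ∃ (π : ∀ v : HeightOneSpectrum (𝓞 K), TamePin v) (L : Set (HeightOneSpectrum (𝓞 K)))
        (hL : L ⊆ (W.eisensteinTower (κ.unitTwist (-1)) hm).degreeTwoPrimes p) (hLS : ∀ v ∈ L, v ∉ S)
        (s₁ : ℕ) (_hsub : ∀ v ∈ (W.eisensteinTower (κ.unitTwist (-1)) hm).kolyvaginPrimes p s₁, v ∉ S → v ∈ L)
        (t : ∀ k, ((W.baseChange K).torsionGaloisModule ((p : ℤ) ^ (k + 1))).toContRepresentation →ⁱL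
          ((W.baseChange K).torsionGaloisModule ((p : ℤ) ^ k)).toContRepresentation)
        (ht : ∀ k (P : geomTorsion (W.baseChange K) ((p : ℤ) ^ (k + 1))),
          t k P = (W.baseChange K).geomTorsionReduce p k P)
        (I : ZpExtension.EisensteinH1Data (κ.unitTwist (-1))
          (fun k ↦ (W.baseChange K).torsionGaloisModule ((p : ℤ) ^ k)) t hm)
        (jbar' : AlgebraicClosure K →+* ℂ),
        ∀ (cd : ConjugationDatum K)
          (Dd : ∀ k, DualityDatum p cd ((W.eisensteinTower (κ.unitTwist (-1)) hm).ρ k)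
            (IwasawaAlgebra.EisensteinCoeff p m (k + 1)))
          (hy : (W.eisensteinDVRSettingLevelsTame (κ.unitTwist (-1)) hm π S hpS hbad L hL hLS jbar' cd Dd).SatisfiesH),
          ∃ κKS : (W.eisensteinDVRSettingLevelsTame (κ.unitTwist (-1)) hm π S hpS hbad L hL hLS jbar' cd Dd).KolyvaginSystem,
            κKS.one ≠ 0 ∧
            ∀ k, κKS.one k = I.proj (k + 1) (D.toEisensteinH1Linear hm t ht I hyp.topGenerator hyp.noPTorsion z) := by
  intro N _ W _ K _ _ p _ κ γ jbar hyp _ _ _ D C X z hz hcyc hfinS _ htor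
  haveI := hyp.isElliptic
  have hK : IsImaginaryQuadratic K := hyp.isImaginaryQuadratic
  have hπ0 : ∀ v : HeightOneSpectrum (𝓞 K), Nonempty (TamePin v) := nonempty_tamePin
  obtain ⟨m₁, hKS⟩ := W.exists_ksLink_of_thm411 κ h411 hyp jbar D C z hz hcyc hfinS htor
  refine ⟨CastellaGrossiLeeSkinner2022.placesDividing K (p * N) CastellaGrossiLeeSkinner2022.mul_level_ne_zero,
    fun _ hv ↦ CastellaGrossiLeeSkinner2022.mem_placesDividing_of_dvd CastellaGrossiLeeSkinner2022.mul_level_ne_zero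
      (dvd_mul_right p N) hv,
    fun _ hv _ ↦ CastellaGrossiLeeSkinner2022.hasGoodReductionAt_of_not_mem_placesDividing W hyp.level
      CastellaGrossiLeeSkinner2022.mul_level_ne_zero hv,
    fun _ hv ↦ CastellaGrossiLeeSkinner2022.natCast_mem_or_natCast_mem_of_mem_placesDividing
      CastellaGrossiLeeSkinner2022.mul_level_ne_zero hv,
    fun σ v hv ↦ CastellaGrossiLeeSkinner2022.mem_placesDividing_of_smul_mem CastellaGrossiLeeSkinner2022.mul_level_ne_zero
      σ v hv,
    m₁, fun m hm hle ↦ ?_⟩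
  letI := IwasawaAlgebra.isDomain_quotient_X_pow_add_C p hm
  letI := IwasawaAlgebra.isDiscreteValuationRing_quotient_X_pow_add_C p hm
  haveI := IwasawaAlgebra.EisensteinCoeff.isLocalRing_succ p hm
  letI := IwasawaAlgebra.EisensteinCoeff.algebraOfSpecSucc p m
  haveI := W.isScalarTower_algebraOfSpecSucc (K := K) (p := p) (m := m)
  letI := W.residueModuleSucc (K := K) (p := p) hm
  refine ⟨fun v ↦ (hπ0 v).some,
    CastellaGrossiLeeSkinner2022.heegnerKolyvaginPrimes W (κ.unitTwist (-1))
      (CastellaGrossiLeeSkinner2022.placesDividing K (p * N) CastellaGrossiLeeSkinner2022.mul_level_ne_zero),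
    W.heegnerKolyvaginPrimes_subset_degreeTwoPrimes_eisensteinTower (κ.unitTwist (-1)) hm (κ.unitTwist (-1))
      (CastellaGrossiLeeSkinner2022.placesDividing K (p * N) CastellaGrossiLeeSkinner2022.mul_level_ne_zero)
      (fun _ hv _ ↦ CastellaGrossiLeeSkinner2022.hasGoodReductionAt_of_not_mem_placesDividing W hyp.level
        CastellaGrossiLeeSkinner2022.mul_level_ne_zero hv),
    fun _ hv ↦ CastellaGrossiLeeSkinner2022.not_mem_of_mem_heegnerKolyvaginPrimes W (κ.unitTwist (-1)) _ hv,
    1, W.kolyvaginPrimes_eisensteinTower_subset_heegnerKolyvaginPrimes (κ.unitTwist (-1)) hm hK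
      (hyp.anticyclotomic.unitTwist (-1)) _ le_rfl,
    fun j ↦ (W.baseChange K).torsionGaloisModuleReduce p j, fun _ _ ↦ rfl,
    (κ.unitTwist (-1)).eisensteinH1Limit (fun k ↦ (W.baseChange K).torsionGaloisModule ((p : ℤ) ^ k))
      (fun j ↦ (W.baseChange K).torsionGaloisModuleReduce p j) hm,
    jbar, fun cd Dd hy ↦ ?_⟩
  exact hKS m hm hle _ cd Dd hy

/-! ## §2 STUB A's core letter without the idle binders -/

set_option synthInstance.maxHeartbeats 80000 in
set_option maxHeartbeats 1600000 in
/-- **Howard's inputs for the Eisenstein DVR settings `S_m` (H.0–H.5, `LargePrimes`, the pushed-forward Kolyvagin system with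
bottom class the control image of `z`, non-zero, `m ≫ 0`), for ANY class number** — the letter
`HeegnerMuPartStubA.Stmt.howardInputsCore` with the idle binders `¬ W.HasCM`, `HasPadicScalarImage`, `p ∣ h_K` DELETED, from the four
inputs Poitou–Tate / H.4 at `S` / H.5(b) at `S` (the landed letters, which never carried those binders) and §1; D1's `obtain` chain
(`howardInputs_of_clauses`) VERBATIM.
[cite: Howard2004HeegnerKolyvagin, §1.3 H.0–H.5, Thm. 1.6.1, proof of Thm. 2.2.10] [cite: CastellaGrossiLeeSkinner2022, Thm. 4.1.1, §3.2, §3.4] -/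
theorem howardInputsCore_anyClassNumber_of_clauses (hPT : HeegnerMuPartH4AtS.Stmt.poitouTate)
    (H4 : HeegnerMuPartH4AtS.Stmt.h4AtS) (H5 : HeegnerMuPartStubA.Stmt.h5bAtS)
    (h411 : Literature.NumberTheory.EllipticCurves.CastellaGrossiLeeSkinner2022.thm411_exists_kolyvaginSystem_one_ne_zero) :
  ∀ (N : ℕ) [NeZero N] (W : WeierstrassCurve ℚ) [W.IsGloballyMinimal] (K : Type) [Field K] [NumberField K]
    (p : ℕ) [Fact p.Prime] (κ : ZpExtension K p) (γ : Field.absoluteGaloisGroup K)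
    (jbar : AlgebraicClosure K →+* ℂ) (hyp : CastellaGrossiLeeSkinner2022.Thm413Hypotheses N W K p κ γ),
    W.HasIrreducibleModPGaloisRep p → (W.baseChange K).HasIrreducibleModPGaloisRep p →
    SatisfiesHeegnerHypothesis p K →
    ∀ (D : (W.baseChange K).LambdaAdicSelmerData κ γ)
      (C : CastellaGrossiLeeSkinner2022.StabilizedHeegnerData N W K κ jbar)
      (X : (W.baseChange K).SelmerDualData κ γ) (z : D.S),
    (∀ (k : ℕ) (hk : C.depth < k), D.proj k z ∈ CastellaGrossiLeeSkinner2022.stabilizedClassLayer C k hk) →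
    CastellaGrossiLeeSkinner2022.stabilizedHeegnerModule D C = Submodule.span (IwasawaAlgebra p) {z} →
    Module.Finite (IwasawaAlgebra p) D.S → Module.Finite (IwasawaAlgebra p) X.X →
    Module.IsTorsion (IwasawaAlgebra p) (D.S ⧸ CastellaGrossiLeeSkinner2022.stabilizedHeegnerModule D C) →
    ∃ m₀ : ℕ, ∀ (m : ℕ) (hm : 1 ≤ m), m₀ ≤ m →
      haveI := hyp.isElliptic
      letI := IwasawaAlgebra.isDomain_quotient_X_pow_add_C p hm
      letI := IwasawaAlgebra.isDiscreteValuationRing_quotient_X_pow_add_C p hm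
      haveI := IwasawaAlgebra.EisensteinCoeff.isLocalRing_succ p hm
      letI := IwasawaAlgebra.EisensteinCoeff.algebraOfSpecSucc p m
      haveI := W.isScalarTower_algebraOfSpecSucc (K := K) (p := p) (m := m)
      letI := W.residueModuleSucc (K := K) (p := p) hm
      ∃ (S : Finset (IsDedekindDomain.HeightOneSpectrum (NumberField.RingOfIntegers K)))
        (hpS : ∀ v, ((p : ℕ) : NumberField.RingOfIntegers K) ∈ v.asIdeal → v ∈ S)
        (hbad : ∀ v, v ∉ S → ((p : ℕ) : NumberField.RingOfIntegers K) ∉ v.asIdeal →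
          (W.baseChange K).HasGoodReductionAt v)
        (_hSN : ∀ v ∈ S, ((p : ℕ) : NumberField.RingOfIntegers K) ∈ v.asIdeal ∨
          ((N : ℕ) : NumberField.RingOfIntegers K) ∈ v.asIdeal)
        (_hSσ : ∀ (σ : K ≃ₐ[ℚ] K) (v : IsDedekindDomain.HeightOneSpectrum (NumberField.RingOfIntegers K)),
          σ • v ∈ S → v ∈ S)
        (L : Set (IsDedekindDomain.HeightOneSpectrum (NumberField.RingOfIntegers K)))
        (hL : L ⊆ (W.eisensteinTower (κ.unitTwist (-1)) hm).degreeTwoPrimes p)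
        (hLS : ∀ v ∈ L, v ∉ S) (jbar' : AlgebraicClosure K →+* ℂ) (cd : ConjugationDatum K)
        (Dd : ∀ k, DualityDatum p cd ((W.eisensteinTower (κ.unitTwist (-1)) hm).ρ k)
          (IwasawaAlgebra.EisensteinCoeff p m (k + 1)))
        (fs : ∀ (k : ℕ) (n : Finset (IsDedekindDomain.HeightOneSpectrum (NumberField.RingOfIntegers K)))
          (v : IsDedekindDomain.HeightOneSpectrum (NumberField.RingOfIntegers K)),
          galoisCohomology ((W.eisensteinLevelQuot (κ.unitTwist (-1)) hm k n).toLocal (Sum.inr v)) 1 →+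
            SingularQuotient (GaloisRep.toLocal v (W.eisensteinLevelQuot (κ.unitTwist (-1)) hm k n)) ⊗[ℤ]
              Gell v)
        (t : ∀ k, ((W.baseChange K).torsionGaloisModule ((p : ℤ) ^ (k + 1))).toContRepresentation →ⁱL
          ((W.baseChange K).torsionGaloisModule ((p : ℤ) ^ k)).toContRepresentation)
        (ht : ∀ k (P : geomTorsion (W.baseChange K) ((p : ℤ) ^ (k + 1))),
          t k P = (W.baseChange K).geomTorsionReduce p k P)
        (I : ZpExtension.EisensteinH1Data (κ.unitTwist (-1))
          (fun k ↦ (W.baseChange K).torsionGaloisModule ((p : ℤ) ^ k)) t hm)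
        (_hy : (W.eisensteinDVRSetting (κ.unitTwist (-1)) hm S hpS hbad L hL hLS jbar' cd Dd fs).SatisfiesH)
        (κKS : (W.eisensteinDVRSetting (κ.unitTwist (-1)) hm S hpS hbad L hL hLS jbar' cd Dd fs).KolyvaginSystem),
        (W.eisensteinDVRSetting (κ.unitTwist (-1)) hm S hpS hbad L hL hLS jbar' cd Dd fs).LargePrimes ∧
        κKS.one ≠ 0 ∧
        ∀ k, κKS.one k = I.proj (k + 1) (D.toEisensteinH1Linear hm t ht I hyp.topGenerator hyp.noPTorsion z) := by
  intro N _ W _ K _ _ p _ κ γ jbar hyp hirr hirrK hHp D C X z hz hcyc hfinS hfinX htor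
  haveI := hyp.isElliptic
  -- the KS side's set of places `S` (above `p` and `N`, `Aut(K/ℚ)`-stable) and its threshold `m₁`
  obtain ⟨S, hpS, hbad, hSN, hSσ, m₁, hKS⟩ :=
    ksLink_anyClassNumber h411 N W K p κ γ jbar hyp hirr hirrK hHp D C X z hz hcyc hfinS hfinX htor
  obtain ⟨m₄, hH4⟩ := H4 N W K p κ γ hyp hirr hirrK S hpS hbad hSN hSσ
  obtain ⟨m₅, hH5⟩ := H5 N W K p κ γ hyp hirr hirrK S hpS hbad hSN hSσ
  refine ⟨max (max m₁ m₄) m₅, fun m hm hle ↦ ?_⟩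
  have hm1 : m₁ ≤ m := le_trans ((le_max_left _ _).trans (le_max_left _ _)) hle
  have hm4 : m₄ ≤ m := le_trans ((le_max_right _ _).trans (le_max_left _ _)) hle
  have hm5 : m₅ ≤ m := le_trans (le_max_right _ _) hle
  letI := IwasawaAlgebra.isDomain_quotient_X_pow_add_C p hm
  letI := IwasawaAlgebra.isDiscreteValuationRing_quotient_X_pow_add_C p hm
  haveI := IwasawaAlgebra.EisensteinCoeff.isLocalRing_succ p hm
  letI := IwasawaAlgebra.EisensteinCoeff.algebraOfSpecSucc p m
  haveI := W.isScalarTower_algebraOfSpecSucc (K := K) (p := p) (m := m)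
  letI := W.residueModuleSucc (K := K) (p := p) hm
  -- the KS side's choices at `m`
  obtain ⟨π, L, hL, hLS, s₁, hsub, t, ht, I, jbar', hKSm⟩ := hKS m hm hm1
  -- D1: conjugation datum, H.4 data, `SatisfiesH` modulo the `v ∈ S` clauses
  obtain ⟨c₀, σ, hσ₁, hσ, hτl, hτ₂, Dd, e, log, hc₀, hτ, hDe, he_red, h4', h5', h6', h7', h8', h9', hyOf⟩ :=
    HeegnerMuPartHowardSettingERed.exists_eisensteinSettingData_satisfiesH_eRed_of_thm413Hypotheses hyp hirr hirrK (hPT K)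
      (-1) hm π S hpS hbad hSσ L hL hLS jbar'
  have hfin4 := hH4 m hm hm4 L hL hLS c₀ σ hσ₁ hσ hτl hτ₂ Dd e log hc₀ hτ hDe he_red h4' h5' h6' h7' h8' h9'
  have hfin5b := hH5 m hm hm5 π L hL hLS jbar' c₀ σ hσ₁ hσ hτl hτ₂ Dd e log hc₀ hτ hDe he_red h4' h5' h6' h7' h8' h9'
  have hy := hyOf hfin4 hfin5b
  obtain ⟨κKS, hone, hlink⟩ := hKSm _ Dd hy
  have hLP := W.eisensteinDVRSetting_largePrimes (κ.unitTwist (-1)) hm S hpS hbad L hL hLS jbar' _ Dd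
    (W.eisensteinLevelsTameFs (κ.unitTwist (-1)) hm π S hpS hbad L hL hLS) hsub
  exact ⟨S, hpS, hbad, hSN, hSσ, L, hL, hLS, jbar', _, Dd, W.eisensteinLevelsTameFs (κ.unitTwist (-1)) hm π S hpS hbad L hL hLS,
    t, ht, I, hy, κKS, hLP, hone, hlink⟩

set_option synthInstance.maxHeartbeats 80000 in
/-- **STUB A for ANY class number, closed form**: Poitou–Tate (`HeegnerMuPartH4AtS.poitouTate_holds`), H.4 ⟸ (Exact) at `v ∣ p`
(`HeegnerMuPartH4AtS.stub_exactAtP`), H.5(b) ⟸ its level-`0` clause (`HeegnerMuPartH5bAtS.stub_h5bAtSZeroP`) — all kernel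
theorems — and F-411. [cite: Howard2004HeegnerKolyvagin, §1.3 H.0–H.5, Thm. 1.6.1] [cite: CastellaGrossiLeeSkinner2022, Thm. 4.1.1] -/
theorem howardInputsCore_anyClassNumber
    (h411 : Literature.NumberTheory.EllipticCurves.CastellaGrossiLeeSkinner2022.thm411_exists_kolyvaginSystem_one_ne_zero) :
  ∀ (N : ℕ) [NeZero N] (W : WeierstrassCurve ℚ) [W.IsGloballyMinimal] (K : Type) [Field K] [NumberField K]
    (p : ℕ) [Fact p.Prime] (κ : ZpExtension K p) (γ : Field.absoluteGaloisGroup K)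
    (jbar : AlgebraicClosure K →+* ℂ) (hyp : CastellaGrossiLeeSkinner2022.Thm413Hypotheses N W K p κ γ),
    W.HasIrreducibleModPGaloisRep p → (W.baseChange K).HasIrreducibleModPGaloisRep p →
    SatisfiesHeegnerHypothesis p K →
    ∀ (D : (W.baseChange K).LambdaAdicSelmerData κ γ)
      (C : CastellaGrossiLeeSkinner2022.StabilizedHeegnerData N W K κ jbar)
      (X : (W.baseChange K).SelmerDualData κ γ) (z : D.S),
    (∀ (k : ℕ) (hk : C.depth < k), D.proj k z ∈ CastellaGrossiLeeSkinner2022.stabilizedClassLayer C k hk) →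
    CastellaGrossiLeeSkinner2022.stabilizedHeegnerModule D C = Submodule.span (IwasawaAlgebra p) {z} →
    Module.Finite (IwasawaAlgebra p) D.S → Module.Finite (IwasawaAlgebra p) X.X →
    Module.IsTorsion (IwasawaAlgebra p) (D.S ⧸ CastellaGrossiLeeSkinner2022.stabilizedHeegnerModule D C) →
    ∃ m₀ : ℕ, ∀ (m : ℕ) (hm : 1 ≤ m), m₀ ≤ m →
      haveI := hyp.isElliptic
      letI := IwasawaAlgebra.isDomain_quotient_X_pow_add_C p hm
      letI := IwasawaAlgebra.isDiscreteValuationRing_quotient_X_pow_add_C p hm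
      haveI := IwasawaAlgebra.EisensteinCoeff.isLocalRing_succ p hm
      letI := IwasawaAlgebra.EisensteinCoeff.algebraOfSpecSucc p m
      haveI := W.isScalarTower_algebraOfSpecSucc (K := K) (p := p) (m := m)
      letI := W.residueModuleSucc (K := K) (p := p) hm
      ∃ (S : Finset (IsDedekindDomain.HeightOneSpectrum (NumberField.RingOfIntegers K)))
        (hpS : ∀ v, ((p : ℕ) : NumberField.RingOfIntegers K) ∈ v.asIdeal → v ∈ S)
        (hbad : ∀ v, v ∉ S → ((p : ℕ) : NumberField.RingOfIntegers K) ∉ v.asIdeal →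
          (W.baseChange K).HasGoodReductionAt v)
        (_hSN : ∀ v ∈ S, ((p : ℕ) : NumberField.RingOfIntegers K) ∈ v.asIdeal ∨
          ((N : ℕ) : NumberField.RingOfIntegers K) ∈ v.asIdeal)
        (_hSσ : ∀ (σ : K ≃ₐ[ℚ] K) (v : IsDedekindDomain.HeightOneSpectrum (NumberField.RingOfIntegers K)),
          σ • v ∈ S → v ∈ S)
        (L : Set (IsDedekindDomain.HeightOneSpectrum (NumberField.RingOfIntegers K)))
        (hL : L ⊆ (W.eisensteinTower (κ.unitTwist (-1)) hm).degreeTwoPrimes p)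
        (hLS : ∀ v ∈ L, v ∉ S) (jbar' : AlgebraicClosure K →+* ℂ) (cd : ConjugationDatum K)
        (Dd : ∀ k, DualityDatum p cd ((W.eisensteinTower (κ.unitTwist (-1)) hm).ρ k)
          (IwasawaAlgebra.EisensteinCoeff p m (k + 1)))
        (fs : ∀ (k : ℕ) (n : Finset (IsDedekindDomain.HeightOneSpectrum (NumberField.RingOfIntegers K)))
          (v : IsDedekindDomain.HeightOneSpectrum (NumberField.RingOfIntegers K)),
          galoisCohomology ((W.eisensteinLevelQuot (κ.unitTwist (-1)) hm k n).toLocal (Sum.inr v)) 1 →+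
            SingularQuotient (GaloisRep.toLocal v (W.eisensteinLevelQuot (κ.unitTwist (-1)) hm k n)) ⊗[ℤ]
              Gell v)
        (t : ∀ k, ((W.baseChange K).torsionGaloisModule ((p : ℤ) ^ (k + 1))).toContRepresentation →ⁱL
          ((W.baseChange K).torsionGaloisModule ((p : ℤ) ^ k)).toContRepresentation)
        (ht : ∀ k (P : geomTorsion (W.baseChange K) ((p : ℤ) ^ (k + 1))),
          t k P = (W.baseChange K).geomTorsionReduce p k P)
        (I : ZpExtension.EisensteinH1Data (κ.unitTwist (-1))
          (fun k ↦ (W.baseChange K).torsionGaloisModule ((p : ℤ) ^ k)) t hm)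
        (_hy : (W.eisensteinDVRSetting (κ.unitTwist (-1)) hm S hpS hbad L hL hLS jbar' cd Dd fs).SatisfiesH)
        (κKS : (W.eisensteinDVRSetting (κ.unitTwist (-1)) hm S hpS hbad L hL hLS jbar' cd Dd fs).KolyvaginSystem),
        (W.eisensteinDVRSetting (κ.unitTwist (-1)) hm S hpS hbad L hL hLS jbar' cd Dd fs).LargePrimes ∧
        κKS.one ≠ 0 ∧
        ∀ k, κKS.one k = I.proj (k + 1) (D.toEisensteinH1Linear hm t ht I hyp.topGenerator hyp.noPTorsion z) :=
  howardInputsCore_anyClassNumber_of_clauses HeegnerMuPartH4AtS.poitouTate_holds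
    (HeegnerMuPartH4AtS.h4AtS_of_exactAtP' HeegnerMuPartH4AtS.stub_exactAtP)
    (HeegnerMuPartH5bAtS.h5bAtSERed_of_clauseZeroP HeegnerMuPartH5bAtS.stub_h5bAtSZeroP) h411

end Summit.BirchSwinnertonDyer.BirchSwinnertonDyer.Theorems.HeegnerMuPartKSAnyClassNumber

end
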